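import Summits.QuantumFields.YangMills.Theorems.BalabanUVNodesN15KingModelBlockFieldDeterminant
import Summits.QuantumFields.YangMills.Theorems.BalabanUVNodesN15KingModelTheorem21Rate
import HarnessLib

/-!
# BalabanUVNodes ∕ N15 — THE KING-MODEL RUNG (PART Ε-o): THE DETERMINANT OF KING's CONTINUUM EFFECTIVE LAPLACIAN `det Δ^{(∞)} = Π_q Δ^{(∞)}(p′(q))`
# AND THE `η`-RATE OF THE BLOCK-FIELD NORMALISATION — `|log det Δ^{(K)} − log det Δ^{(∞)}| ≤ |Ω|·C·L^{−2K}` (King's (3.93) shape, free model)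
# (Track A, DAG node N15 = NE2; FAN-OUT v1.1 §N15 s3 «KING-MODEL RUNG»; companion of Ε-n and Ϡ-g ∕ Ϝ-c; count-neutral)

HONEST FRAMING.  Count-neutral (cell `pub-ymgap`, seat `pub-ymgap-dag-n15-e` g40; `--supports stmt-QuantumFields-27366 --as helper` = K3⁸).
TEMPLATE LITERATURE: C. King, Commun. Math. Phys. **102** (1986) 649–677 [King1986], (2.6) p.652 and (3.89) p.668 (the Gaussian normalisations `ln N_k = −½ ln det Δ^{(k)}`
up to Lebesgue factors), (3.93) p.669 (their rate: `|ln N_k − ln N_{k+n}| ≤ … ≤ CL^{−2k}·#sites`, via Prop. 3.10), Lemma 4.3 (4.18) p.672 (the symbol rate), (4.5) p.670.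
PART Ε-n gave `det Δ^{(K)} = Π_q effSym(q)` and `log det Δ^{(K)} = Σ_q log effSym(q)`; part Ϡ-g gave the entrywise limit `Δ^{(K)} → Δ^{(∞)}` (`effLaplacianLim`, closed
form) along King's scales `N = L^K`, `a = a_K`, `c = L^{2K}`; parts Ϡ-g∕Ϝ-c gave the UNIFORM symbol rate `|Δ^{(K)}(p′(q)) − Δ^{(∞)}(p′(q))| ≤ C_Δ(a)·L^{−2K}` and the uniform
floor `δ_∞ = (a_∞⁻¹ + m⁻²)⁻¹` under both symbols.  THIS FILE: §1 ★★★ **`det_effLaplacianLim_eq_prod`** — `det Δ^{(∞)} = Π_{q∈Ω̂} Δ^{(∞)}(p′(q))` with NO evenness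
argument: `det` is continuous, `det Δ^{(K)} = Π_q effSym_K(q) → Π_q Δ^{(∞)}(p′(q))`, limits are unique (`tendsto_effLaplacian_matrix`, `tendsto_det_effLaplacian`,
`tendsto_prod_effSym`); `det_effLaplacianLim_pos`, ★★ **`log_det_effLaplacianLim`** (`= Σ_q log Δ^{(∞)}(p′(q))`), `log_det_effLaplacianLim_bounds` (`|Ω|log δ_∞ ≤ · ≤ |Ω|log a_∞`).
§2 ★★★ **`abs_log_det_effLaplacian_sub_lim_le`** — KING's (3.93) SHAPE FOR THE FREE BLOCK FIELD: for `L` odd `≥ 2`, `a, m² > 0`, `K ≥ 1` and every unit torus,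
`|log det Δ^{(K)} − log det Δ^{(∞)}| ≤ |Ω|·(δ_∞⁻¹·C_Δ(a))·L^{−2K}`, `C_Δ(a) = (8∕3)a²(a⁻¹ + π²∕48 + 1∕3) + (4∕3)a` — EXTENSIVE with rate `η² = L^{−2K}`; per site
★★ **`abs_log_det_div_card_sub_lim_le`**; hence ★★ **`tendsto_log_det_effLaplacian`** (`log det Δ^{(K)} → log det Δ^{(∞)}`).

PRIOR TREE ART (used, not restated): part Ε-n (`det_effLaplacian_eq_prod_effSym`, `log_det_effLaplacian`), part Ϡ-g (`effLaplacianLim`, `tendsto_effLaplacian`,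
`effSymLim_le`), part Ϡ-c (`effSymLim`, `effSymLim_pos`, `aInf`, `aInf_pos`, `tendsto_effSym_pow`), part Ϡ-g∕Ϝ-c rate files (`abs_DeltaEff_sub_lim_le`, `DeltaEff_ge_unif`,
`effSymLim_ge_unif`), `King1986` (`effSym_eq_DeltaEff`, `aK`, `aK_pos`), Mathlib (`Continuous.matrix_det`, `tendsto_nhds_unique`, `Real.log_le_sub_one_of_pos`).
NOT Bałaban's covariant objects; NOT a node discharge (N15 is booked through n15-a's knit, untouched); nothing continuum-YM ∕ `ℝ⁴` ∕ OS ∕ Clay.  0 `sorry`, 0 `def`.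

HONEST SCOPE.  King's `A = 0` free model on unit tori `Π_μℤ∕M_μ` (dimension `d+1`), scales `N = L^K` with `L` odd `≥ 2`, `a, m² > 0`; the constant `δ_∞⁻¹C_Δ(a)` is explicit
but not optimised; the identification with `ln N_k` itself (a Gaussian integral) is not made here.  Locators: [King1986] (2.6) p.652, (3.89) p.668, (3.93) p.669, Lemma 4.3 (4.18)
p.672, (4.5) p.670.
-/

noncomputable section

open scoped BigOperators Topology
open Finset Filter Matrix

namespace Summit.QuantumFields.YangMills.BalabanUVNodes.N15KingModelRung.TorusSpectral

open Literature.MathematicalPhysics.QuantumFieldTheory.Balaban1983to89.B5Prop11Plancherel (Tor sOf)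
open Literature.MathematicalPhysics.QuantumFieldTheory.King1986 (aK aK_pos DeltaEff)
open Literature.MathematicalPhysics.QuantumFieldTheory.King1986.Torus

variable {d : ℕ} (L : ℕ) (M : Fin (d + 1) → ℕ) [hM : ∀ μ, NeZero (M μ)]

/-! ## §1 The determinant of `Δ^{(∞)}` -/

/-- the effective Laplacians converge AS MATRICES (entrywise = in the product topology) to `Δ^{(∞)}`. [cite: King1986, Thm 3.4 (3.9) p.656, (2.14) p.653] -/
theorem tendsto_effLaplacian_matrix (hLodd : Odd L) (hL : 2 ≤ L) {a m2 : ℝ} (ha : 0 < a) (hm : 0 < m2) :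
    haveI : NeZero L := ⟨by omega⟩
    Tendsto (fun K : ℕ => effLaplacian (L ^ K) M (aK a L K) (((L ^ K : ℕ) : ℝ) ^ 2) m2) atTop
      (𝓝 (Matrix.of fun b b' => effLaplacianLim L M a m2 b b')) := by
  haveI : NeZero L := ⟨by omega⟩
  refine tendsto_pi_nhds.mpr fun b => tendsto_pi_nhds.mpr fun b' => ?_
  exact tendsto_effLaplacian L M hLodd hL ha hm b b'

/-- `det Δ^{(K)} → det Δ^{(∞)}` (`det` is continuous). [cite: King1986, (3.89) p.668, Thm 3.4 (3.9) p.656] -/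
theorem tendsto_det_effLaplacian (hLodd : Odd L) (hL : 2 ≤ L) {a m2 : ℝ} (ha : 0 < a) (hm : 0 < m2) :
    haveI : NeZero L := ⟨by omega⟩
    Tendsto (fun K : ℕ => (effLaplacian (L ^ K) M (aK a L K) (((L ^ K : ℕ) : ℝ) ^ 2) m2).det) atTop
      (𝓝 (Matrix.of fun b b' => effLaplacianLim L M a m2 b b').det) :=
  ((continuous_id.matrix_det).tendsto _).comp (tendsto_effLaplacian_matrix L M hLodd hL ha hm)

/-- `Π_q effSym_K(q) → Π_q Δ^{(∞)}(p′(q))`. [cite: King1986, (4.5) p.670] -/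
theorem tendsto_prod_effSym (hLodd : Odd L) (hL : 2 ≤ L) {a m2 : ℝ} (ha : 0 < a) (hm : 0 < m2) :
    haveI : NeZero L := ⟨by omega⟩
    Tendsto (fun K : ℕ => ∏ q : Tor M, effSym (L ^ K) M (aK a L K) (((L ^ K : ℕ) : ℝ) ^ 2) m2 q) atTop
      (𝓝 (∏ q : Tor M, effSymLim a L m2 (sOf M q))) :=
  tendsto_finsetProd _ fun q _ => tendsto_effSym_pow L M hLodd hL ha hm q

/-- ★★★ **THE DETERMINANT OF KING's CONTINUUM EFFECTIVE LAPLACIAN**: `det Δ^{(∞)} = Π_{q∈Ω̂} Δ^{(∞)}(p′(q))` (`L` odd `≥ 2`, `a, m² > 0`, every unit torus) — by uniqueness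
of limits from Ε-n's `det Δ^{(K)} = Π_q effSym_K(q)`. [cite: King1986, (3.89) p.668, (4.5) p.670, Thm 3.4 (3.9) p.656] -/
theorem det_effLaplacianLim_eq_prod (hLodd : Odd L) (hL : 2 ≤ L) {a m2 : ℝ} (ha : 0 < a) (hm : 0 < m2) :
    (Matrix.of fun b b' => effLaplacianLim L M a m2 b b').det = ∏ q : Tor M, effSymLim a L m2 (sOf M q) := by
  haveI : NeZero L := ⟨by omega⟩
  have hL1 : (1 : ℝ) < L := by exact_mod_cast (show 1 < L by omega)
  refine tendsto_nhds_unique (tendsto_det_effLaplacian L M hLodd hL ha hm) ((tendsto_prod_effSym L M hLodd hL ha hm).congr' ?_)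
  filter_upwards [eventually_ge_atTop 1] with K hK
  exact (det_effLaplacian_eq_prod_effSym (L ^ K) M (aK_pos ha hL1 hK).le (by positivity) hm).symm

/-- `det Δ^{(∞)} > 0`. [cite: King1986, (3.89) p.668] -/
theorem det_effLaplacianLim_pos (hLodd : Odd L) (hL : 2 ≤ L) {a m2 : ℝ} (ha : 0 < a) (hm : 0 < m2) :
    0 < (Matrix.of fun b b' => effLaplacianLim L M a m2 b b').det := by
  have hL1 : (1 : ℝ) < L := by exact_mod_cast (show 1 < L by omega)
  rw [det_effLaplacianLim_eq_prod L M hLodd hL ha hm]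
  exact Finset.prod_pos fun q _ => effSymLim_pos ha hL1 hm.le _

/-- ★★ **`log det Δ^{(∞)} = Σ_{q∈Ω̂} log Δ^{(∞)}(p′(q))`**. [cite: King1986, (3.89) p.668, (4.5) p.670] -/
theorem log_det_effLaplacianLim (hLodd : Odd L) (hL : 2 ≤ L) {a m2 : ℝ} (ha : 0 < a) (hm : 0 < m2) :
    Real.log (Matrix.of fun b b' => effLaplacianLim L M a m2 b b').det = ∑ q : Tor M, Real.log (effSymLim a L m2 (sOf M q)) := by
  have hL1 : (1 : ℝ) < L := by exact_mod_cast (show 1 < L by omega)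
  rw [det_effLaplacianLim_eq_prod L M hLodd hL ha hm, Real.log_prod]
  exact fun q _ => (effSymLim_pos ha hL1 hm.le _).ne'

/-- `|Ω|·log δ_∞ ≤ log det Δ^{(∞)} ≤ |Ω|·log a_∞`, `δ_∞ = (a_∞⁻¹ + m⁻²)⁻¹`. [cite: King1986, (3.89) p.668, (4.5) p.670, (4.8) p.671] -/
theorem log_det_effLaplacianLim_bounds (hLodd : Odd L) (hL : 2 ≤ L) {a m2 : ℝ} (ha : 0 < a) (hm : 0 < m2) :
    (Fintype.card (Tor M) : ℝ) * Real.log ((aInf a L)⁻¹ + m2⁻¹)⁻¹ ≤ Real.log (Matrix.of fun b b' => effLaplacianLim L M a m2 b b').det ∧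
      Real.log (Matrix.of fun b b' => effLaplacianLim L M a m2 b b').det ≤ (Fintype.card (Tor M) : ℝ) * Real.log (aInf a L) := by
  have hL1 : (1 : ℝ) < L := by exact_mod_cast (show 1 < L by omega)
  have haI := aInf_pos ha hL1
  have hδ : 0 < ((aInf a L)⁻¹ + m2⁻¹)⁻¹ := by positivity
  rw [log_det_effLaplacianLim L M hLodd hL ha hm]
  constructor
  · calc (Fintype.card (Tor M) : ℝ) * Real.log ((aInf a L)⁻¹ + m2⁻¹)⁻¹ = ∑ _q : Tor M, Real.log ((aInf a L)⁻¹ + m2⁻¹)⁻¹ := by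
          rw [Finset.sum_const, Finset.card_univ, nsmul_eq_mul]
      _ ≤ _ := Finset.sum_le_sum fun q _ => Real.log_le_log hδ (effSymLim_ge_unif L M hLodd hL ha hm q)
  · calc ∑ q : Tor M, Real.log (effSymLim a L m2 (sOf M q)) ≤ ∑ _q : Tor M, Real.log (aInf a L) :=
          Finset.sum_le_sum fun q _ => Real.log_le_log (effSymLim_pos ha hL1 hm.le _) (effSymLim_le ha hL1 hm.le _)
      _ = _ := by rw [Finset.sum_const, Finset.card_univ, nsmul_eq_mul]

/-! ## §2 King's (3.93) shape: the `η`-rate of `log det Δ^{(K)}` -/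

/-- ★★★ **THE `η`-RATE OF THE BLOCK-FIELD NORMALISATION (King's (3.93) shape, free model)**: for `L` odd `≥ 2`, `a, m² > 0`, `K ≥ 1` and every unit torus,
`|log det Δ^{(K)} − log det Δ^{(∞)}| ≤ |Ω|·(δ_∞⁻¹·C_Δ(a))·L^{−2K}` — extensive in the volume, rate `η² = L^{−2K}` (symbol rate of Lemma 4.3 + `log` is `δ_∞⁻¹`-Lipschitz on
`[δ_∞, ∞)`). [cite: King1986, (3.93) p.669, (3.89) p.668, Lemma 4.3 (4.18) p.672, (4.5) p.670] -/
theorem abs_log_det_effLaplacian_sub_lim_le (hLodd : Odd L) (hL : 2 ≤ L) {a m2 : ℝ} (ha : 0 < a) (hm : 0 < m2) {K : ℕ} (hK : 1 ≤ K) :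
    haveI : NeZero L := ⟨by omega⟩
    |Real.log (effLaplacian (L ^ K) M (aK a L K) (((L ^ K : ℕ) : ℝ) ^ 2) m2).det - Real.log (Matrix.of fun b b' => effLaplacianLim L M a m2 b b').det|
      ≤ (Fintype.card (Tor M) : ℝ) * (((aInf a L)⁻¹ + m2⁻¹) * (8 / 3 * (a ^ 2 * (a⁻¹ + Real.pi ^ 2 / 48 + 1 / 3)) + 4 / 3 * a))
        * ((L : ℝ) ^ (2 * K))⁻¹ := by
  haveI : NeZero L := ⟨by omega⟩
  have hL1 : (1 : ℝ) < L := by exact_mod_cast (show 1 < L by omega)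
  have haK := aK_pos ha hL1 hK
  have haI := aInf_pos ha hL1
  have hLK : 1 ≤ L ^ K := Nat.one_le_pow K L (by omega)
  set δ : ℝ := ((aInf a L)⁻¹ + m2⁻¹)⁻¹ with hδdef
  have hδ : 0 < δ := by positivity
  -- `log` is `δ⁻¹`-Lipschitz on `[δ, ∞)`
  have hlog : ∀ x y : ℝ, δ ≤ x → δ ≤ y → |Real.log x - Real.log y| ≤ |x - y| / δ := by
    intro x y hx hy
    have hx0 : 0 < x := lt_of_lt_of_le hδ hx
    have hy0 : 0 < y := lt_of_lt_of_le hδ hy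
    rw [abs_le]
    constructor
    · -- `log y − log x ≤ (y − x)∕x ≤ |x − y|∕δ`
      have h1 : Real.log y - Real.log x ≤ (y - x) / x :=
        calc Real.log y - Real.log x = Real.log (y / x) := (Real.log_div hy0.ne' hx0.ne').symm
          _ ≤ y / x - 1 := Real.log_le_sub_one_of_pos (div_pos hy0 hx0)
          _ = (y - x) / x := by field_simp
      have h2 : (y - x) / x ≤ |x - y| / δ := by
        rw [div_le_div_iff₀ hx0 hδ]
        calc (y - x) * δ ≤ |x - y| * δ := mul_le_mul_of_nonneg_right (by rw [abs_sub_comm]; exact le_abs_self _) hδ.le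
          _ ≤ |x - y| * x := mul_le_mul_of_nonneg_left hx (abs_nonneg _)
      linarith
    · have h1 : Real.log x - Real.log y ≤ (x - y) / y :=
        calc Real.log x - Real.log y = Real.log (x / y) := (Real.log_div hx0.ne' hy0.ne').symm
          _ ≤ x / y - 1 := Real.log_le_sub_one_of_pos (div_pos hx0 hy0)
          _ = (x - y) / y := by field_simp
      have h2 : (x - y) / y ≤ |x - y| / δ := by
        rw [div_le_div_iff₀ hy0 hδ]
        calc (x - y) * δ ≤ |x - y| * δ := mul_le_mul_of_nonneg_right (le_abs_self _) hδ.le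
          _ ≤ |x - y| * y := mul_le_mul_of_nonneg_left hy (abs_nonneg _)
      linarith
  rw [log_det_effLaplacian (L ^ K) M haK (by positivity) hm, log_det_effLaplacianLim L M hLodd hL ha hm, ← Finset.sum_sub_distrib]
  refine (Finset.abs_sum_le_sum_abs _ _).trans ?_
  have hterm : ∀ q : Tor M, |Real.log (effSym (L ^ K) M (aK a L K) (((L ^ K : ℕ) : ℝ) ^ 2) m2 q) - Real.log (effSymLim a L m2 (sOf M q))|
      ≤ ((aInf a L)⁻¹ + m2⁻¹) * (8 / 3 * (a ^ 2 * (a⁻¹ + Real.pi ^ 2 / 48 + 1 / 3)) + 4 / 3 * a) * ((L : ℝ) ^ (2 * K))⁻¹ := by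
    intro q
    rw [effSym_eq_DeltaEff (L ^ K) M hLK haK hm q]
    have hx := DeltaEff_ge_unif L M hL ha hm hK q
    have hy := effSymLim_ge_unif L M hLodd hL ha hm q
    have hr := abs_DeltaEff_sub_lim_le L M hLodd hL ha hm hK q
    calc _ ≤ |DeltaEff (aK a L K) (L ^ K) m2 (sOf M q) - effSymLim a L m2 (sOf M q)| / δ := hlog _ _ hx hy
      _ ≤ (8 / 3 * (a ^ 2 * (a⁻¹ + Real.pi ^ 2 / 48 + 1 / 3)) + 4 / 3 * a) * ((L : ℝ) ^ (2 * K))⁻¹ / δ := div_le_div_of_nonneg_right hr hδ.le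
      _ = _ := by rw [hδdef, div_eq_mul_inv, inv_inv]; ring
  calc ∑ q : Tor M, |Real.log (effSym (L ^ K) M (aK a L K) (((L ^ K : ℕ) : ℝ) ^ 2) m2 q) - Real.log (effSymLim a L m2 (sOf M q))|
      ≤ ∑ _q : Tor M, ((aInf a L)⁻¹ + m2⁻¹) * (8 / 3 * (a ^ 2 * (a⁻¹ + Real.pi ^ 2 / 48 + 1 / 3)) + 4 / 3 * a) * ((L : ℝ) ^ (2 * K))⁻¹ :=
        Finset.sum_le_sum fun q _ => hterm q
    _ = _ := by rw [Finset.sum_const, Finset.card_univ, nsmul_eq_mul]; ring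

/-- ★★ **PER SITE**: `| |Ω|⁻¹log det Δ^{(K)} − |Ω|⁻¹log det Δ^{(∞)} | ≤ (δ_∞⁻¹·C_Δ(a))·L^{−2K}` — the normalisation PER SITE converges at rate `η²`, uniformly in the volume.
[cite: King1986, (3.93) p.669, (3.89) p.668] -/
theorem abs_log_det_div_card_sub_lim_le (hLodd : Odd L) (hL : 2 ≤ L) {a m2 : ℝ} (ha : 0 < a) (hm : 0 < m2) {K : ℕ} (hK : 1 ≤ K) :
    haveI : NeZero L := ⟨by omega⟩
    |(Fintype.card (Tor M) : ℝ)⁻¹ * Real.log (effLaplacian (L ^ K) M (aK a L K) (((L ^ K : ℕ) : ℝ) ^ 2) m2).det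
        - (Fintype.card (Tor M) : ℝ)⁻¹ * Real.log (Matrix.of fun b b' => effLaplacianLim L M a m2 b b').det|
      ≤ ((aInf a L)⁻¹ + m2⁻¹) * (8 / 3 * (a ^ 2 * (a⁻¹ + Real.pi ^ 2 / 48 + 1 / 3)) + 4 / 3 * a) * ((L : ℝ) ^ (2 * K))⁻¹ := by
  haveI : NeZero L := ⟨by omega⟩
  have hcard : (0 : ℝ) < Fintype.card (Tor M) := by exact_mod_cast Fintype.card_pos
  have h := abs_log_det_effLaplacian_sub_lim_le L M hLodd hL ha hm hK
  rw [← mul_sub, abs_mul, abs_inv, abs_of_pos hcard, ← div_eq_inv_mul, div_le_iff₀ hcard]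
  calc _ ≤ _ := h
    _ = _ := by ring

/-- ★★ **`log det Δ^{(K)} → log det Δ^{(∞)}`** as `K → ∞` (`L` odd `≥ 2`, `a, m² > 0`, every unit torus). [cite: King1986, (3.89) p.668, (3.93) p.669, Thm 3.4 (3.9) p.656] -/
theorem tendsto_log_det_effLaplacian (hLodd : Odd L) (hL : 2 ≤ L) {a m2 : ℝ} (ha : 0 < a) (hm : 0 < m2) :
    haveI : NeZero L := ⟨by omega⟩
    Tendsto (fun K : ℕ => Real.log (effLaplacian (L ^ K) M (aK a L K) (((L ^ K : ℕ) : ℝ) ^ 2) m2).det) atTop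
      (𝓝 (Real.log (Matrix.of fun b b' => effLaplacianLim L M a m2 b b').det)) :=
  ((Real.continuousAt_log (det_effLaplacianLim_pos L M hLodd hL ha hm).ne').tendsto).comp (tendsto_det_effLaplacian L M hLodd hL ha hm)

end Summit.QuantumFields.YangMills.BalabanUVNodes.N15KingModelRung.TorusSpectral

end
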